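import Mathlib
import HarnessLib
import Summits.HubbardSuperconductivity.HubbardSuperconductivity.Theorems.KLProgrammeKLRegimeVolumeLimitTwoPointTimeAssembly
import Summits.HubbardSuperconductivity.HubbardSuperconductivity.Theorems.KLProgrammeKLRegimeVolumeLimitTwoPointTimeAssemblyTools
import Summits.HubbardSuperconductivity.HubbardSuperconductivity.Theorems.KLProgrammeKLRegimeVolumeLimitTwoPointTimeMatch
import Literature.MathematicalPhysics.QuantumLattice.ShiftedHubbardTwoTimeDyson
import Summits.HubbardSuperconductivity.HubbardSuperconductivity.Theorems.KLProgrammeThermalGreenMatsubaraTimeAllU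

/-!
# Child `KLRegimeVolumeLimitV12` (stmt-HubbardSuperconductivity-19858), `stub_vl_bound`: (H1) — the τ-resolved identification of the Grassmann
# two-point limit series — MODULO ONE POINTWISE HYPOTHESIS (k3c5-p1's C2: the free trace of the two-time split-pair word is `Z₀·(−det Ẽ)`)
# (seat hubbard-kl-k3c4-p2, g3; «Matsubara all-U route (R-a)»)

Everything on the Grassmann / integral side of (H1) is now in the tree (this seat: p486529 reduction, p487321 wrapper, p488207/p490142 tools,
p487813–p489021 dictionary, p489878 pointwise match; k3c5-p1: p480117/p484281/p484918 two-time Dyson series, p484561 marked split).  This file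
assembles them: **`hasSum_twoPointLimitDet_series_time_of_C2`** — for `L ≥ 3`, `0 < s < β`, EVERY real `U`:
IF for every generic two-block configuration and all vertex sites `f ⧺ f′` the free (`dΓ h`) trace of p484918's two-time word equals
`Z₀ · (−det Ẽ)` (`Ẽ` = the explicit before-rule matrix of `…TwoPointTimeMatch`, `Z₀ = Tr e^{−βdΓh}`) — this is k3c5-p1's C2
(`gibbsState_dGamma_splitPairWordShift_eq_neg_det`, p489528) after instantiating the letters and one `ext` (`splitPairMatrix − diag(0,½) = Ẽ`) —
THEN the two-point limit series at external times `(s, 0)` (k3c5-p2's p470680 limit) sums to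
`e^{−βU·¼·|Λ|}·Tr(e^{−(β−s)H′} c†_{x̄ₑσ} e^{−sH′} c_{ȳₑσ′}) / Z₀`, `H′ = hamiltonianWith (fermionTorusGraph 2 L) 1 U (μ + U/2)`; and
**`tendsto_twoPoint_hamiltonian_of_C2`** — the same rewritten as ONE CLAUSE OF k3c5-p2's (H1) HYPOTHESIS VERBATIM (the `Tendsto` of the
finite-`M` Grassmann two-point function to `e^{−βUL²/4}·Tr(e^{−(β−s)H′}c†e^{−sH′}c)/Z₀` with `hubbardTorusWith`, as in `hamiltonianBound_of_H1`
(p488909) / `stub_vl_bound_of_H1`), via k3c5-p2's `tendsto_gaussExpect_twoPoint_mul_grassmannExp_allU_time`.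
Instance note (for whoever discharges `hC2` from a generic-`Λ` theorem): generic fermion-lattice theorems instantiated at `FermionTorus 2 L`
carry `LinearOrder.toDecidableEq`, torus statements written out carry `instDecidableEqLex`; the two are equal by `Subsingleton.elim` and one
`rw` with that equation aligns them (see the proof).  Everything is proved; no definition.
-/

noncomputable section

namespace Summit.HubbardSuperconductivity.HubbardSuperconductivity.Theorems.MatsubaraAllU

set_option linter.dupNamespace false -- summit = problem name (single-conjunct summit), D-0017

open MeasureTheory Finset NormedSpace Filter Topology Literature.MathematicalPhysics.QuantumLattice Literature.Probability.LatticeModels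
open scoped Nat ComplexOrder

variable {L : ℕ} [NeZero L]

/-- **(H1) MODULO C2, `HasSum` form.**  See the module docstring. -/
theorem hasSum_twoPointLimitDet_series_time_of_C2 (hL : 3 ≤ L) {β : ℝ} (hβ : 0 < β) (μ U : ℝ) (σ σ' : Fin 2) (xe ye : TorusSite 2 L)
    {s : ℝ} (hs0 : 0 < s) (hsβ : s < β)
    (hC2 : ∀ (k j : ℕ) (u : Fin k → ℝ) (u' : Fin j → ℝ), StrictMono u → StrictMono u' →
      (∀ i, u i ∈ Set.Ioo (0 : ℝ) ((β - s) / β)) → (∀ l, u' l ∈ Set.Ioo (0 : ℝ) (s / β)) →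
      ∀ (f : Fin k → FermionTorus 2 L) (f' : Fin j → FermionTorus 2 L),
        (Matrix.gibbsWeight β (dGamma (hubbardOneBody (fermionTorusGraph 2 L) 1 μ)) * (annihilation (orb (FermionTorus.ofTorusSite ye) σ') *
                ((List.ofFn fun i : Fin k =>
                    ((exp ((((u i : ℝ) : ℂ) * -(β : ℂ)) • dGamma (hubbardOneBody (fermionTorusGraph 2 L) 1 μ)) * creation (orb (f i) 0) *
                          exp (-((((u i : ℝ) : ℂ) * -(β : ℂ)) • dGamma (hubbardOneBody (fermionTorusGraph 2 L) 1 μ)))) *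
                        (exp ((((u i : ℝ) : ℂ) * -(β : ℂ)) • dGamma (hubbardOneBody (fermionTorusGraph 2 L) 1 μ)) * annihilation (orb (f i) 0) *
                          exp (-((((u i : ℝ) : ℂ) * -(β : ℂ)) • dGamma (hubbardOneBody (fermionTorusGraph 2 L) 1 μ)))) -
                      ((1 / 2 : ℝ) : ℂ) • (1 : Matrix (Finset (Orb (FermionTorus 2 L))) (Finset (Orb (FermionTorus 2 L))) ℂ)) *
                    ((exp ((((u i : ℝ) : ℂ) * -(β : ℂ)) • dGamma (hubbardOneBody (fermionTorusGraph 2 L) 1 μ)) * creation (orb (f i) 1) *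
                          exp (-((((u i : ℝ) : ℂ) * -(β : ℂ)) • dGamma (hubbardOneBody (fermionTorusGraph 2 L) 1 μ)))) *
                        (exp ((((u i : ℝ) : ℂ) * -(β : ℂ)) • dGamma (hubbardOneBody (fermionTorusGraph 2 L) 1 μ)) * annihilation (orb (f i) 1) *
                          exp (-((((u i : ℝ) : ℂ) * -(β : ℂ)) • dGamma (hubbardOneBody (fermionTorusGraph 2 L) 1 μ)))) -
                      ((1 / 2 : ℝ) : ℂ) • (1 : Matrix (Finset (Orb (FermionTorus 2 L))) (Finset (Orb (FermionTorus 2 L))) ℂ))).prod *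
                  (exp (((((β - s) / β : ℝ) : ℂ) * -(β : ℂ)) • dGamma (hubbardOneBody (fermionTorusGraph 2 L) 1 μ)) * creation (orb (FermionTorus.ofTorusSite xe) σ) *
                    exp (-(((((β - s) / β : ℝ) : ℂ) * -(β : ℂ)) • dGamma (hubbardOneBody (fermionTorusGraph 2 L) 1 μ)))) *
                  (List.ofFn fun l : Fin j =>
                    ((exp ((((((β - s) / β + u' l : ℝ) : ℂ)) * -(β : ℂ)) • dGamma (hubbardOneBody (fermionTorusGraph 2 L) 1 μ)) * creation (orb (f' l) 0) *
                          exp (-((((((β - s) / β + u' l : ℝ) : ℂ)) * -(β : ℂ)) • dGamma (hubbardOneBody (fermionTorusGraph 2 L) 1 μ)))) *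
                        (exp ((((((β - s) / β + u' l : ℝ) : ℂ)) * -(β : ℂ)) • dGamma (hubbardOneBody (fermionTorusGraph 2 L) 1 μ)) *
                            annihilation (orb (f' l) 0) *
                          exp (-((((((β - s) / β + u' l : ℝ) : ℂ)) * -(β : ℂ)) • dGamma (hubbardOneBody (fermionTorusGraph 2 L) 1 μ)))) -
                      ((1 / 2 : ℝ) : ℂ) • (1 : Matrix (Finset (Orb (FermionTorus 2 L))) (Finset (Orb (FermionTorus 2 L))) ℂ)) *
                    ((exp ((((((β - s) / β + u' l : ℝ) : ℂ)) * -(β : ℂ)) • dGamma (hubbardOneBody (fermionTorusGraph 2 L) 1 μ)) * creation (orb (f' l) 1) *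
                          exp (-((((((β - s) / β + u' l : ℝ) : ℂ)) * -(β : ℂ)) • dGamma (hubbardOneBody (fermionTorusGraph 2 L) 1 μ)))) *
                        (exp ((((((β - s) / β + u' l : ℝ) : ℂ)) * -(β : ℂ)) • dGamma (hubbardOneBody (fermionTorusGraph 2 L) 1 μ)) *
                            annihilation (orb (f' l) 1) *
                          exp (-((((((β - s) / β + u' l : ℝ) : ℂ)) * -(β : ℂ)) • dGamma (hubbardOneBody (fermionTorusGraph 2 L) 1 μ)))) -
                      ((1 / 2 : ℝ) : ℂ) • (1 : Matrix (Finset (Orb (FermionTorus 2 L))) (Finset (Orb (FermionTorus 2 L))) ℂ))).prod))).trace =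
          Matrix.partitionFn β (dGamma (hubbardOneBody (fermionTorusGraph 2 L) 1 μ)) * -(Matrix.of (Fin.cases
          (Fin.cases
            (-(exp (-((0 : ℂ) • hubbardOneBody (fermionTorusGraph 2 L) 1 μ)) *
                (1 + exp (-((β : ℂ) • hubbardOneBody (fermionTorusGraph 2 L) 1 μ)))⁻¹ *
                exp (((((β - s) / β : ℝ) : ℂ) * -(β : ℂ)) • hubbardOneBody (fermionTorusGraph 2 L) 1 μ))
              (orb (FermionTorus.ofTorusSite ye) σ') (orb (FermionTorus.ofTorusSite xe) σ))
            (fun m' : Fin ((k + j) * 2) =>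
              if k ≤ ((finProdFinEquiv.symm m' : Fin (k + j) × Fin 2).1 : ℕ) then
                (exp (-((((Fin.append u (fun l => (β - s) / β + u' l) (finProdFinEquiv.symm m' : Fin (k + j) × Fin 2).1 : ℝ) : ℂ) *
                      -(β : ℂ)) • hubbardOneBody (fermionTorusGraph 2 L) 1 μ)) *
                    (1 + exp ((β : ℂ) • hubbardOneBody (fermionTorusGraph 2 L) 1 μ))⁻¹ *
                    exp (((((β - s) / β : ℝ) : ℂ) * -(β : ℂ)) • hubbardOneBody (fermionTorusGraph 2 L) 1 μ))
                  (orb (FermionTorus.ofTorusSite (FermionTorus.toTorusSite (Fin.append f f' (finProdFinEquiv.symm m' : Fin (k + j) × Fin 2).1)))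
                    (finProdFinEquiv.symm m' : Fin (k + j) × Fin 2).2) (orb (FermionTorus.ofTorusSite xe) σ)
              else
                -(exp (-((((Fin.append u (fun l => (β - s) / β + u' l) (finProdFinEquiv.symm m' : Fin (k + j) × Fin 2).1 : ℝ) : ℂ) *
                      -(β : ℂ)) • hubbardOneBody (fermionTorusGraph 2 L) 1 μ)) *
                    (1 + exp (-((β : ℂ) • hubbardOneBody (fermionTorusGraph 2 L) 1 μ)))⁻¹ *
                    exp (((((β - s) / β : ℝ) : ℂ) * -(β : ℂ)) • hubbardOneBody (fermionTorusGraph 2 L) 1 μ))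
                  (orb (FermionTorus.ofTorusSite (FermionTorus.toTorusSite (Fin.append f f' (finProdFinEquiv.symm m' : Fin (k + j) × Fin 2).1)))
                    (finProdFinEquiv.symm m' : Fin (k + j) × Fin 2).2) (orb (FermionTorus.ofTorusSite xe) σ)))
          (fun m : Fin ((k + j) * 2) => Fin.cases
            (-(exp (-((0 : ℂ) • hubbardOneBody (fermionTorusGraph 2 L) 1 μ)) *
                (1 + exp (-((β : ℂ) • hubbardOneBody (fermionTorusGraph 2 L) 1 μ)))⁻¹ *
                exp ((((Fin.append u (fun l => (β - s) / β + u' l) (finProdFinEquiv.symm m : Fin (k + j) × Fin 2).1 : ℝ) : ℂ) *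
                  -(β : ℂ)) • hubbardOneBody (fermionTorusGraph 2 L) 1 μ))
              (orb (FermionTorus.ofTorusSite ye) σ')
              (orb (FermionTorus.ofTorusSite (FermionTorus.toTorusSite (Fin.append f f' (finProdFinEquiv.symm m : Fin (k + j) × Fin 2).1)))
                (finProdFinEquiv.symm m : Fin (k + j) × Fin 2).2))
            (fun m' : Fin ((k + j) * 2) =>
              twoPointWordMatrix L β μ σ σ' xe ye (fun a => FermionTorus.toTorusSite (Fin.append f f' a)) (Fin.append u (fun l => (β - s) / β + u' l)) m.succ m'.succ)) :
          Fin ((k + j) * 2 + 1) → Fin ((k + j) * 2 + 1) → ℂ)).det) :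
    HasSum (fun n : ℕ => ((-1 : ℂ) ^ n * ((n ! : ℂ))⁻¹) * ((U : ℂ) ^ n * ∑ x : Fin n → TorusSite 2 L,
        ∫ τ in Set.Icc (0 : Fin n → ℝ) (fun _ => β),
        (Matrix.of fun i j' : Fin (n * 2 + 1) =>
          vertexLimitEntry L β μ ((Fin.append x ![xe, ye] : Fin (n + 2) → TorusSite 2 L) (twoPointPlusEnum n σ i).1)
            ((Fin.append x ![xe, ye] : Fin (n + 2) → TorusSite 2 L) (twoPointMinusEnum n σ' j').1)
            (twoPointPlusEnum n σ i).2 (twoPointMinusEnum n σ' j').2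
            ((Fin.append τ ![s, 0] : Fin (n + 2) → ℝ) (twoPointMinusEnum n σ' j').1 -
              (Fin.append τ ![s, 0] : Fin (n + 2) → ℝ) (twoPointPlusEnum n σ i).1)).det))
      (((Real.exp (-(β * (U * (1 / 2 : ℝ) ^ 2 * Fintype.card (FermionTorus 2 L)))) : ℂ) *
          (Matrix.gibbsWeight (β - s) (hamiltonianWith (fermionTorusGraph 2 L) 1 U (μ + U * (1 / 2 : ℝ))) *
              creation (orb (FermionTorus.ofTorusSite xe) σ) *
            (Matrix.gibbsWeight s (hamiltonianWith (fermionTorusGraph 2 L) 1 U (μ + U * (1 / 2 : ℝ))) *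
              annihilation (orb (FermionTorus.ofTorusSite ye) σ'))).trace) /
        Matrix.partitionFn β (dGamma (hubbardOneBody (fermionTorusGraph 2 L) 1 μ))) := by
  haveI : Nonempty (Finset (Orb (FermionTorus 2 L))) := ⟨∅⟩
  -- instance alignment: generic-`Λ` theorems carry `LinearOrder.toDecidableEq`, torus statements `instDecidableEqLex`
  have hinst : (LinearOrder.toDecidableEq : DecidableEq (FermionTorus 2 L)) = instDecidableEqLex (Fin 2 → Fin L) :=
    Subsingleton.elim _ _
  have hZ₀ : Matrix.partitionFn β (dGamma (hubbardOneBody (fermionTorusGraph 2 L) 1 μ)) ≠ 0 :=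
    (Matrix.partitionFn_pos β (isHermitian_dGamma (isHermitian_hubbardOneBody (fermionTorusGraph 2 L) 1 μ))).ne'
  -- the Hamiltonian two-time Dyson series of p484918 (k3c5-p1): Hubbard torus, `t = 1`, `ν = 1/2`
  have hH := hasSum_hubbard_twoPoint_twoTime_renormalised_trace (fermionTorusGraph 2 L) hβ 1 U μ (1 / 2)
    (FermionTorus.ofTorusSite xe) (FermionTorus.ofTorusSite ye) σ σ' hs0.le hsβ.le
  rw [hinst] at hH
  refine hasSum_twoPointTime_of_ae_match hβ μ U σ σ' xe ye hs0.le hsβ.le hZ₀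
    (fun (k j : ℕ) (u : Fin k → ℝ) (u' : Fin j → ℝ) =>
            (-(β : ℂ)) ^ (k + j) * ∑ f : Fin k → FermionTorus 2 L, ∑ f' : Fin j → FermionTorus 2 L,
              (Matrix.gibbsWeight β (dGamma (hubbardOneBody (fermionTorusGraph 2 L) 1 μ)) * (annihilation (orb (FermionTorus.ofTorusSite ye) σ') *
                ((List.ofFn fun i : Fin k =>
                    ((exp ((((u i : ℝ) : ℂ) * -(β : ℂ)) • dGamma (hubbardOneBody (fermionTorusGraph 2 L) 1 μ)) * creation (orb (f i) 0) *
                          exp (-((((u i : ℝ) : ℂ) * -(β : ℂ)) • dGamma (hubbardOneBody (fermionTorusGraph 2 L) 1 μ)))) *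
                        (exp ((((u i : ℝ) : ℂ) * -(β : ℂ)) • dGamma (hubbardOneBody (fermionTorusGraph 2 L) 1 μ)) * annihilation (orb (f i) 0) *
                          exp (-((((u i : ℝ) : ℂ) * -(β : ℂ)) • dGamma (hubbardOneBody (fermionTorusGraph 2 L) 1 μ)))) -
                      ((1 / 2 : ℝ) : ℂ) • (1 : Matrix (Finset (Orb (FermionTorus 2 L))) (Finset (Orb (FermionTorus 2 L))) ℂ)) *
                    ((exp ((((u i : ℝ) : ℂ) * -(β : ℂ)) • dGamma (hubbardOneBody (fermionTorusGraph 2 L) 1 μ)) * creation (orb (f i) 1) *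
                          exp (-((((u i : ℝ) : ℂ) * -(β : ℂ)) • dGamma (hubbardOneBody (fermionTorusGraph 2 L) 1 μ)))) *
                        (exp ((((u i : ℝ) : ℂ) * -(β : ℂ)) • dGamma (hubbardOneBody (fermionTorusGraph 2 L) 1 μ)) * annihilation (orb (f i) 1) *
                          exp (-((((u i : ℝ) : ℂ) * -(β : ℂ)) • dGamma (hubbardOneBody (fermionTorusGraph 2 L) 1 μ)))) -
                      ((1 / 2 : ℝ) : ℂ) • (1 : Matrix (Finset (Orb (FermionTorus 2 L))) (Finset (Orb (FermionTorus 2 L))) ℂ))).prod *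
                  (exp (((((β - s) / β : ℝ) : ℂ) * -(β : ℂ)) • dGamma (hubbardOneBody (fermionTorusGraph 2 L) 1 μ)) * creation (orb (FermionTorus.ofTorusSite xe) σ) *
                    exp (-(((((β - s) / β : ℝ) : ℂ) * -(β : ℂ)) • dGamma (hubbardOneBody (fermionTorusGraph 2 L) 1 μ)))) *
                  (List.ofFn fun l : Fin j =>
                    ((exp ((((((β - s) / β + u' l : ℝ) : ℂ)) * -(β : ℂ)) • dGamma (hubbardOneBody (fermionTorusGraph 2 L) 1 μ)) * creation (orb (f' l) 0) *
                          exp (-((((((β - s) / β + u' l : ℝ) : ℂ)) * -(β : ℂ)) • dGamma (hubbardOneBody (fermionTorusGraph 2 L) 1 μ)))) *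
                        (exp ((((((β - s) / β + u' l : ℝ) : ℂ)) * -(β : ℂ)) • dGamma (hubbardOneBody (fermionTorusGraph 2 L) 1 μ)) *
                            annihilation (orb (f' l) 0) *
                          exp (-((((((β - s) / β + u' l : ℝ) : ℂ)) * -(β : ℂ)) • dGamma (hubbardOneBody (fermionTorusGraph 2 L) 1 μ)))) -
                      ((1 / 2 : ℝ) : ℂ) • (1 : Matrix (Finset (Orb (FermionTorus 2 L))) (Finset (Orb (FermionTorus 2 L))) ℂ)) *
                    ((exp ((((((β - s) / β + u' l : ℝ) : ℂ)) * -(β : ℂ)) • dGamma (hubbardOneBody (fermionTorusGraph 2 L) 1 μ)) * creation (orb (f' l) 1) *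
                          exp (-((((((β - s) / β + u' l : ℝ) : ℂ)) * -(β : ℂ)) • dGamma (hubbardOneBody (fermionTorusGraph 2 L) 1 μ)))) *
                        (exp ((((((β - s) / β + u' l : ℝ) : ℂ)) * -(β : ℂ)) • dGamma (hubbardOneBody (fermionTorusGraph 2 L) 1 μ)) *
                            annihilation (orb (f' l) 1) *
                          exp (-((((((β - s) / β + u' l : ℝ) : ℂ)) * -(β : ℂ)) • dGamma (hubbardOneBody (fermionTorusGraph 2 L) 1 μ)))) -
                      ((1 / 2 : ℝ) : ℂ) • (1 : Matrix (Finset (Orb (FermionTorus 2 L))) (Finset (Orb (FermionTorus 2 L))) ℂ))).prod))).trace)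
    (fun k j => ?_) hH (fun k j => ?_)
  · have hc := continuous_hubbard_twoTime_integrand (fermionTorusGraph 2 L) β 1 μ (1 / 2) (FermionTorus.ofTorusSite xe)
      (FermionTorus.ofTorusSite ye) σ σ' s k j
    rw [hinst] at hc
    exact hc
  -- the a.e. match on the marked piece `(k, j)`: C2 termwise, the regrouping of the two vertex blocks, the pointwise match
  filter_upwards [ae_restrict_simplex_strictMono_Ioo k ((β - s) / β)] with u hu
  filter_upwards [ae_restrict_simplex_strictMono_Ioo j (s / β)] with u' hu'
  congr 1
  rw [Finset.sum_congr rfl fun f _ => Finset.sum_congr rfl fun f' _ => hC2 k j u u' hu.1 hu'.1 hu.2 hu'.2 f f']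
  simp_rw [← Finset.mul_sum]
  congr 1
  rw [← sum_sum_append_comp_equiv_eq_sum (k := k) (j := j) FermionTorus.equivTorusSite]
  refine Finset.sum_congr rfl fun f _ => Finset.sum_congr rfl fun f' _ => ?_
  rw [twoPointTimeDet_eq_neg_det_beforeRule hL hβ μ σ σ' xe ye hs0 hsβ
    (fun a => FermionTorus.equivTorusSite (Fin.append f f' a)) hu.1 hu'.1 hu.2 hu'.2]
  rfl

/-- **(H1) MODULO C2, as one clause of k3c5-p2's hypothesis `hH1`** (`hamiltonianBound_of_H1`, `stub_vl_bound_of_H1`): for `L ≥ 3`, `β > 0`,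
real `U, μ`, sites `x, y`, `s ∈ (0,β)`, under C2 at `(x, y, s)`, the finite-`M` Grassmann two-point function
`∫dμ_{C_M} ψ⁺_{(x,s)σ} ψ⁻_{(y,0)σ'} e^{−V}` converges, as `M → ∞`, to `e^{−βUL²/4}·Tr(e^{−(β−s)H′} c†_{x̄σ} e^{−sH′} c_{ȳσ′}) / Tr e^{−βH₀}`,
`H′ = hubbardTorusWith 2 L 1 U (μ + U/2)`, `H₀ = hubbardTorusWith 2 L 1 0 μ`. -/
theorem tendsto_twoPoint_hamiltonian_of_C2 (hL : 3 ≤ L) {β : ℝ} (hβ : 0 < β) (μ U : ℝ) (σ σ' : Fin 2) (xe ye : TorusSite 2 L)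
    {s : ℝ} (hs : s ∈ Set.Ioo (0 : ℝ) β)
    (hC2 : ∀ (k j : ℕ) (u : Fin k → ℝ) (u' : Fin j → ℝ), StrictMono u → StrictMono u' →
      (∀ i, u i ∈ Set.Ioo (0 : ℝ) ((β - s) / β)) → (∀ l, u' l ∈ Set.Ioo (0 : ℝ) (s / β)) →
      ∀ (f : Fin k → FermionTorus 2 L) (f' : Fin j → FermionTorus 2 L),
        (Matrix.gibbsWeight β (dGamma (hubbardOneBody (fermionTorusGraph 2 L) 1 μ)) * (annihilation (orb (FermionTorus.ofTorusSite ye) σ') *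
                ((List.ofFn fun i : Fin k =>
                    ((exp ((((u i : ℝ) : ℂ) * -(β : ℂ)) • dGamma (hubbardOneBody (fermionTorusGraph 2 L) 1 μ)) * creation (orb (f i) 0) *
                          exp (-((((u i : ℝ) : ℂ) * -(β : ℂ)) • dGamma (hubbardOneBody (fermionTorusGraph 2 L) 1 μ)))) *
                        (exp ((((u i : ℝ) : ℂ) * -(β : ℂ)) • dGamma (hubbardOneBody (fermionTorusGraph 2 L) 1 μ)) * annihilation (orb (f i) 0) *
                          exp (-((((u i : ℝ) : ℂ) * -(β : ℂ)) • dGamma (hubbardOneBody (fermionTorusGraph 2 L) 1 μ)))) -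
                      ((1 / 2 : ℝ) : ℂ) • (1 : Matrix (Finset (Orb (FermionTorus 2 L))) (Finset (Orb (FermionTorus 2 L))) ℂ)) *
                    ((exp ((((u i : ℝ) : ℂ) * -(β : ℂ)) • dGamma (hubbardOneBody (fermionTorusGraph 2 L) 1 μ)) * creation (orb (f i) 1) *
                          exp (-((((u i : ℝ) : ℂ) * -(β : ℂ)) • dGamma (hubbardOneBody (fermionTorusGraph 2 L) 1 μ)))) *
                        (exp ((((u i : ℝ) : ℂ) * -(β : ℂ)) • dGamma (hubbardOneBody (fermionTorusGraph 2 L) 1 μ)) * annihilation (orb (f i) 1) *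
                          exp (-((((u i : ℝ) : ℂ) * -(β : ℂ)) • dGamma (hubbardOneBody (fermionTorusGraph 2 L) 1 μ)))) -
                      ((1 / 2 : ℝ) : ℂ) • (1 : Matrix (Finset (Orb (FermionTorus 2 L))) (Finset (Orb (FermionTorus 2 L))) ℂ))).prod *
                  (exp (((((β - s) / β : ℝ) : ℂ) * -(β : ℂ)) • dGamma (hubbardOneBody (fermionTorusGraph 2 L) 1 μ)) * creation (orb (FermionTorus.ofTorusSite xe) σ) *
                    exp (-(((((β - s) / β : ℝ) : ℂ) * -(β : ℂ)) • dGamma (hubbardOneBody (fermionTorusGraph 2 L) 1 μ)))) *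
                  (List.ofFn fun l : Fin j =>
                    ((exp ((((((β - s) / β + u' l : ℝ) : ℂ)) * -(β : ℂ)) • dGamma (hubbardOneBody (fermionTorusGraph 2 L) 1 μ)) * creation (orb (f' l) 0) *
                          exp (-((((((β - s) / β + u' l : ℝ) : ℂ)) * -(β : ℂ)) • dGamma (hubbardOneBody (fermionTorusGraph 2 L) 1 μ)))) *
                        (exp ((((((β - s) / β + u' l : ℝ) : ℂ)) * -(β : ℂ)) • dGamma (hubbardOneBody (fermionTorusGraph 2 L) 1 μ)) *
                            annihilation (orb (f' l) 0) *
                          exp (-((((((β - s) / β + u' l : ℝ) : ℂ)) * -(β : ℂ)) • dGamma (hubbardOneBody (fermionTorusGraph 2 L) 1 μ)))) -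
                      ((1 / 2 : ℝ) : ℂ) • (1 : Matrix (Finset (Orb (FermionTorus 2 L))) (Finset (Orb (FermionTorus 2 L))) ℂ)) *
                    ((exp ((((((β - s) / β + u' l : ℝ) : ℂ)) * -(β : ℂ)) • dGamma (hubbardOneBody (fermionTorusGraph 2 L) 1 μ)) * creation (orb (f' l) 1) *
                          exp (-((((((β - s) / β + u' l : ℝ) : ℂ)) * -(β : ℂ)) • dGamma (hubbardOneBody (fermionTorusGraph 2 L) 1 μ)))) *
                        (exp ((((((β - s) / β + u' l : ℝ) : ℂ)) * -(β : ℂ)) • dGamma (hubbardOneBody (fermionTorusGraph 2 L) 1 μ)) *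
                            annihilation (orb (f' l) 1) *
                          exp (-((((((β - s) / β + u' l : ℝ) : ℂ)) * -(β : ℂ)) • dGamma (hubbardOneBody (fermionTorusGraph 2 L) 1 μ)))) -
                      ((1 / 2 : ℝ) : ℂ) • (1 : Matrix (Finset (Orb (FermionTorus 2 L))) (Finset (Orb (FermionTorus 2 L))) ℂ))).prod))).trace =
          Matrix.partitionFn β (dGamma (hubbardOneBody (fermionTorusGraph 2 L) 1 μ)) * -(Matrix.of (Fin.cases
          (Fin.cases
            (-(exp (-((0 : ℂ) • hubbardOneBody (fermionTorusGraph 2 L) 1 μ)) *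
                (1 + exp (-((β : ℂ) • hubbardOneBody (fermionTorusGraph 2 L) 1 μ)))⁻¹ *
                exp (((((β - s) / β : ℝ) : ℂ) * -(β : ℂ)) • hubbardOneBody (fermionTorusGraph 2 L) 1 μ))
              (orb (FermionTorus.ofTorusSite ye) σ') (orb (FermionTorus.ofTorusSite xe) σ))
            (fun m' : Fin ((k + j) * 2) =>
              if k ≤ ((finProdFinEquiv.symm m' : Fin (k + j) × Fin 2).1 : ℕ) then
                (exp (-((((Fin.append u (fun l => (β - s) / β + u' l) (finProdFinEquiv.symm m' : Fin (k + j) × Fin 2).1 : ℝ) : ℂ) *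
                      -(β : ℂ)) • hubbardOneBody (fermionTorusGraph 2 L) 1 μ)) *
                    (1 + exp ((β : ℂ) • hubbardOneBody (fermionTorusGraph 2 L) 1 μ))⁻¹ *
                    exp (((((β - s) / β : ℝ) : ℂ) * -(β : ℂ)) • hubbardOneBody (fermionTorusGraph 2 L) 1 μ))
                  (orb (FermionTorus.ofTorusSite (FermionTorus.toTorusSite (Fin.append f f' (finProdFinEquiv.symm m' : Fin (k + j) × Fin 2).1)))
                    (finProdFinEquiv.symm m' : Fin (k + j) × Fin 2).2) (orb (FermionTorus.ofTorusSite xe) σ)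
              else
                -(exp (-((((Fin.append u (fun l => (β - s) / β + u' l) (finProdFinEquiv.symm m' : Fin (k + j) × Fin 2).1 : ℝ) : ℂ) *
                      -(β : ℂ)) • hubbardOneBody (fermionTorusGraph 2 L) 1 μ)) *
                    (1 + exp (-((β : ℂ) • hubbardOneBody (fermionTorusGraph 2 L) 1 μ)))⁻¹ *
                    exp (((((β - s) / β : ℝ) : ℂ) * -(β : ℂ)) • hubbardOneBody (fermionTorusGraph 2 L) 1 μ))
                  (orb (FermionTorus.ofTorusSite (FermionTorus.toTorusSite (Fin.append f f' (finProdFinEquiv.symm m' : Fin (k + j) × Fin 2).1)))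
                    (finProdFinEquiv.symm m' : Fin (k + j) × Fin 2).2) (orb (FermionTorus.ofTorusSite xe) σ)))
          (fun m : Fin ((k + j) * 2) => Fin.cases
            (-(exp (-((0 : ℂ) • hubbardOneBody (fermionTorusGraph 2 L) 1 μ)) *
                (1 + exp (-((β : ℂ) • hubbardOneBody (fermionTorusGraph 2 L) 1 μ)))⁻¹ *
                exp ((((Fin.append u (fun l => (β - s) / β + u' l) (finProdFinEquiv.symm m : Fin (k + j) × Fin 2).1 : ℝ) : ℂ) *
                  -(β : ℂ)) • hubbardOneBody (fermionTorusGraph 2 L) 1 μ))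
              (orb (FermionTorus.ofTorusSite ye) σ')
              (orb (FermionTorus.ofTorusSite (FermionTorus.toTorusSite (Fin.append f f' (finProdFinEquiv.symm m : Fin (k + j) × Fin 2).1)))
                (finProdFinEquiv.symm m : Fin (k + j) × Fin 2).2))
            (fun m' : Fin ((k + j) * 2) =>
              twoPointWordMatrix L β μ σ σ' xe ye (fun a => FermionTorus.toTorusSite (Fin.append f f' a)) (Fin.append u (fun l => (β - s) / β + u' l)) m.succ m'.succ)) :
          Fin ((k + j) * 2 + 1) → Fin ((k + j) * 2 + 1) → ℂ)).det) :
    Tendsto (fun M : ℕ => gaussExpect ℂ (hubbardCovariance L M β μ 0)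
        (positionField L M β 0 σ xe s * positionField L M β 1 σ' ye 0 * grassmannExp (-(hubbardInteraction L M β U)))) atTop
      (𝓝 ((Real.exp (-(β * U / 4 * (L : ℝ) ^ 2)) : ℂ) *
          (Matrix.gibbsWeight (β - s) (hubbardTorusWith 2 L 1 U (μ + U / 2)) * creation (orb (FermionTorus.ofTorusSite xe) σ) *
            (Matrix.gibbsWeight s (hubbardTorusWith 2 L 1 U (μ + U / 2)) * annihilation (orb (FermionTorus.ofTorusSite ye) σ'))).trace /
          Matrix.partitionFn β (hubbardTorusWith 2 L 1 0 μ))) := by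
  haveI : Nonempty (Finset (Orb (FermionTorus 2 L))) := ⟨∅⟩
  have hA := hasSum_twoPointLimitDet_series_time_of_C2 hL hβ μ U σ σ' xe ye hs.1 hs.2 hC2
  have hT := tendsto_gaussExpect_twoPoint_mul_grassmannExp_allU_time hβ μ U σ σ' xe ye ⟨hs.1.le, hs.2⟩ (Set.left_mem_Ico.2 hβ)
  rw [hA.tsum_eq] at hT
  have hcard : (Fintype.card (FermionTorus 2 L) : ℝ) = (L : ℝ) ^ 2 := by
    simp [FermionTorus, Fintype.card_lex]
  have h1 : hubbardTorusWith 2 L 1 U (μ + U / 2) = hamiltonianWith (fermionTorusGraph 2 L) 1 U (μ + U * (1 / 2 : ℝ)) := by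
    rw [show μ + U * (1 / 2 : ℝ) = μ + U / 2 by ring]; rfl
  have h2 : hubbardTorusWith 2 L 1 0 μ = dGamma (hubbardOneBody (fermionTorusGraph 2 L) 1 μ) :=
    hamiltonianWith_zero_eq_dGamma (fermionTorusGraph 2 L) 1 μ
  have h3 : (Real.exp (-(β * U / 4 * (L : ℝ) ^ 2)) : ℂ) =
      (Real.exp (-(β * (U * (1 / 2 : ℝ) ^ 2 * Fintype.card (FermionTorus 2 L)))) : ℂ) := by
    rw [hcard]; congr 2; ring
  rw [h1, h2, h3]
  exact hT

end Summit.HubbardSuperconductivity.HubbardSuperconductivity.Theorems.MatsubaraAllU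

end
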